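/-
Origin: expansion seat `planner-pub-hodgecm-pv14-0`, handover 2026-08-18 (`HOME/pub-hodgecm-pv14/lean/Pv14/PerL34/P43WeilModel.lean`, md5 78153823, 101 lines);
landed by the gen-6 packager in gate run 22 as `HodgeCM/PerL34/P43_weilModel.lean` (import ^import Pv14\.PerL34\.P43Bridge\b→import HodgeCM.PerL34.P43_bridge ×1; import ^import Pv14\.PerL34\.P43Isotypic\b→import HodgeCM.PerL34.P43_isotypic ×1).
-/
/-
Origin: HOME/pub-hodgecm-pv14/lean/Pv14/PerL34/P43WeilModel.lean — session planner-pub-hodgecm-pv14-0 (unit pub-hodgecm-pv14,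
node N33b holder).  Intended final place: `HodgeCM/PerL34/P43_weilModel.lean`, after `P43_bridge.lean` (pv14, v2) and
`P43_isotypic.lean` (pv14).  KERNEL capstone: the N33b-level GROUP INPUTS of the line-span construction (pv03
`BallSpanModel.GroupInputs` = pv02 `LineSpanData` binders `LeftInvariant ∧ CompactInvariant ∧ FiniteStable ∧
UHolomorphic ∧ SomeNonzero`) from ONE typed "Weil model" per fixed line and character, whose fields are PRINT /
DEFINITIONAL primitives only.  Nothing cited, nothing asserted.
-/
import Summits.HodgeConjecture.HodgeCM.PerL34.P43_bridge
import Summits.HodgeConjecture.HodgeCM.PerL34.P43_isotypic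

/-!
# N33b capstone: the group inputs from the Weil-representation typing

`WeilTyping M ωinf ρ ρP` packages, for one theta-kernel model `M` (one allowed datum `(W_i, μ_i, χ'_i)`), the
PRIMITIVE structure behind N33b's hypotheses:
* `Θ`, `hθ`      — DEFINITIONAL: `θ_φ(x) = Θ(ω(x)φ)` for ONE linear map `Θ` (tex l. 264–266: sum over `L₀`-points,
                   `∫` against `χ'_i` over the compact `[U(W_i)]`, `𝔭₊`-packaging);
* `hmul*`, `hcomm*` — PRINT (l. 342 / §3.2): `ω` is a representation of the product group
                   `G_∞ × ∏_{b≠ι₁} U(V_{3,b}) × G_U(𝔸_f)`: each factor map multiplicative, factors pairwise commuting,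
                   and `ω(h_f)` commutes with `ω(K_∞)`;
* `hP`           — DEFINITIONAL: `S[𝔭₊ ⊠ 𝟏] = (𝔭₊-isotypic for K_{ι₁}) ⊓ (fixed by the compact factors)`.
`groupInputs_of_weilModel` then delivers pv03/pv02's five group inputs from: such a typing per `(i, χ)`; N10 in
invariant form (`hΘ : Θ ∘ ω(γ) = Θ`, `γ ∈ Γ`); (X1) per `(i, χ)` (itself `P43X1Bridge.thetaPKilledByPminus_of_KTypes`
← BW VI 4.9/4.11 + N31 + dictionary); (X2) (PRINT-DERIVED, BW II 4.2 (6)); `SomeNonzero` (← N30 + N33a).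
-/

set_option autoImplicit false

namespace HodgeCM
namespace PerL34
namespace P43WeilModel

open P43Isotypic

/-- The Weil-representation typing of one theta-kernel model (see the module docstring for the label of each field). -/
structure WeilTyping {Ginf Gc Gf V S : Type*} [Group Ginf] [Group Gc] [Group Gf] [AddCommGroup V] [Module ℂ V]
    [AddCommGroup S] [Module ℂ S] (M : P43Forms.ThetaKernelData Ginf Gc Gf V S) {Kc P : Type*} [AddCommGroup P]
    [Module ℂ P] (ωinf : Ginf → S →ₗ[ℂ] S) (ρ : Kc → S →ₗ[ℂ] S) (ρP : Kc → P →ₗ[ℂ] P) where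
  /-- the theta distribution (paired with `χ'_i`, `𝔭₊`-packaged) -/
  Θ : S →ₗ[ℂ] V
  hθ : ∀ φ x, M.theta φ x = Θ (ωinf x.1 (M.ωc x.2.1 (M.ωf x.2.2 φ)))
  hmulI : ∀ g g' : Ginf, ωinf (g' * g) = ωinf g' ∘ₗ ωinf g
  hmulC : ∀ c c' : Gc, M.ωc (c' * c) = M.ωc c' ∘ₗ M.ωc c
  hmulF : ∀ h h' : Gf, M.ωf (h' * h) = M.ωf h' ∘ₗ M.ωf h
  hcommIC : ∀ (g : Ginf) (c : Gc), ωinf g ∘ₗ M.ωc c = M.ωc c ∘ₗ ωinf g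
  hcommIF : ∀ (g : Ginf) (h : Gf), ωinf g ∘ₗ M.ωf h = M.ωf h ∘ₗ ωinf g
  hcommCF : ∀ (c : Gc) (h : Gf), M.ωc c ∘ₗ M.ωf h = M.ωf h ∘ₗ M.ωc c
  hcommK : ∀ (h : Gf) (k : Kc), M.ωf h ∘ₗ ρ k = ρ k ∘ₗ M.ωf h
  hP : M.Ptype = isotypic ρ ρP ⊓ fixedSub M.ωc

namespace WeilTyping

variable {Ginf Gc Gf V S : Type*} [Group Ginf] [Group Gc] [Group Gf] [AddCommGroup V] [Module ℂ V]
  [AddCommGroup S] [Module ℂ S] {M : P43Forms.ThetaKernelData Ginf Gc Gf V S} {Kc P : Type*} [AddCommGroup P]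
  [Module ℂ P] {ωinf : Ginf → S →ₗ[ℂ] S} {ρ : Kc → S →ₗ[ℂ] S} {ρP : Kc → P →ₗ[ℂ] P}
  (W : WeilTyping M ωinf ρ ρP)
include W

/-- (Ported verbatim from the HodgeCMPerL package; no docstring in the source.) -/
theorem thetaEquivariantF : M.ThetaEquivariantF := thetaEquivariantF_of_weil M ωinf W.Θ W.hθ W.hmulF

/-- (Ported verbatim from the HodgeCMPerL package; no docstring in the source.) -/
theorem thetaEquivariantC : M.ThetaEquivariantC :=
  thetaEquivariantC_of_weil M ωinf W.Θ W.hθ W.hmulC (fun h c => (W.hcommCF c h).symm)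

/-- (Ported verbatim from the HodgeCMPerL package; no docstring in the source.) -/
theorem ptypeStableF : M.PtypeStableF :=
  (ptype_binders_of_typing M ρ ρP W.hP W.hcommK (fun h c => (W.hcommCF c h).symm)).1

/-- (Ported verbatim from the HodgeCMPerL package; no docstring in the source.) -/
theorem ptypeFixedC : M.PtypeFixedC :=
  (ptype_binders_of_typing M ρ ρP W.hP W.hcommK (fun h c => (W.hcommCF c h).symm)).2

/-- left invariance from N10 in invariant form -/
theorem leftInvariant (Γ : Subgroup (Ginf × Gc × Gf))
    (hΘ : ∀ γ ∈ Γ, W.Θ ∘ₗ (ωinf γ.1 ∘ₗ M.ωc γ.2.1 ∘ₗ M.ωf γ.2.2) = W.Θ) : M.LeftInvariant Γ :=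
  leftInvariant_of_weil M ωinf W.Θ W.hθ W.hmulI W.hmulC W.hmulF W.hcommIC W.hcommIF W.hcommCF Γ hΘ

end WeilTyping

/-- **N33b capstone.**  The five group inputs of the line-span construction (pv02 `LineSpanData` binders = pv03
`BallSpanModel.GroupInputs`) from: one Weil typing per fixed line `i` and character `χ`; N10 (`hΘ`); (X1) per
`(i, χ)`; (X2); `SomeNonzero`. -/
theorem groupInputs_of_weilModel (D : P43.LineSpanData) (FD : P43Forms.FormsDictionary D.Ginf D.V)
    (hHol : FD.Hol = D.Hol)
    (S : (i : Fin 2) → D.X i → Type) [∀ i χ, AddCommGroup (S i χ)] [∀ i χ, Module ℂ (S i χ)]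
    (M : (i : Fin 2) → (χ : D.X i) → P43Forms.ThetaKernelData D.Ginf D.Gc D.Gf D.V (S i χ))
    (hM : ∀ i χ, (M i χ).ThetaP = D.ThetaP i χ)
    {Kc P : Type} [AddCommGroup P] [Module ℂ P] (ρP : Kc → P →ₗ[ℂ] P)
    (ωinf : (i : Fin 2) → (χ : D.X i) → D.Ginf → S i χ →ₗ[ℂ] S i χ)
    (ρ : (i : Fin 2) → (χ : D.X i) → Kc → S i χ →ₗ[ℂ] S i χ)
    (W : ∀ i χ, WeilTyping (M i χ) (ωinf i χ) (ρ i χ) ρP)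
    (hΘ : ∀ i χ, ∀ γ ∈ D.Γ,
      (W i χ).Θ ∘ₗ (ωinf i χ γ.1 ∘ₗ (M i χ).ωc γ.2.1 ∘ₗ (M i χ).ωf γ.2.2) = (W i χ).Θ)
    (hX1 : ∀ i χ, P43Forms.ThetaPKilledByPminus FD (M i χ)) (hX2 : P43Forms.HolomorphicOfPminus FD)
    (hne : D.SomeNonzero) :
    D.LeftInvariant ∧ D.CompactInvariant ∧ D.FiniteStable ∧ D.UHolomorphic ∧ D.SomeNonzero :=
  P43Bridge.groupInputs_of_N33b D FD hHol S M hM (fun i χ => (W i χ).leftInvariant D.Γ (hΘ i χ))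
    (fun i χ => (W i χ).thetaEquivariantC) (fun i χ => (W i χ).ptypeFixedC)
    (fun i χ => (W i χ).thetaEquivariantF) (fun i χ => (W i χ).ptypeStableF) hX1 hX2 hne

end P43WeilModel
end PerL34
end HodgeCM
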